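import Summits.ResolutionOfSingularities.ResolutionOfSingularities.Theorems.AbsoluteQFrame
import HarnessLib

/-!
# AbsoluteQFrameWrapper — decomp-res node «AbsoluteContactInsep» (lens-6 g18), tree file 3/10 of the node

Content VERBATIM from the decomp-res lens-6 g18 file `HOME/decomp-res-lens-6/g18/AbsoluteContactInsep.lean` (sha256
3771488be5d3cd2c, 1966 l; HOME =
run/shared/lean/pub/decomp-res).  Critic: CRITIC-LEDGER row 139 (CLEARED 2026-08-30T20:11:48Z, DECIDED +1:
`AbsContactOff3` proved for every p ≠ 3 and every
field, hypothesis-free); split per the lens's NODE-g18 §8 writer package (sections kept whole; two packages halved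
for the 400-line limit).  Landed by
decomp-res writer g7 in the lens's namespace `…Theorems.AbsoluteContactClasses` (cone-free chain); the wiring
`Theorems/MaxContactCutAbsContactOff3`
(`agAbsContactOff3 : AGAbsContactOff3`, item 27752) follows the chain.  No new aside, nothing superseded; asides
31574 / 27753 / 27896 are ⟺ each other
hypothesis-free by this node.

Section `SchemeWrapper` (l. 605–667): `HasQFrames`, `absContactOff3_of_hasQFrames`.

[WRITER NOTE (decomp-res writer g7): file split only; namespace, opens, section variables and every declaration
exactly as in the lens (global `set_option` dropped).]

## The lens's node description (VERBATIM)

# AbsoluteContactInsep (decomp-res lens 6, generation 18) — the new lemma `AbsContactOff3` PROVED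
for EVERY base field (inseparable residue fields included): `theorem absContactOff3 : AbsContactOff3`,
0 sorry, axioms `[propext, Classical.choice, Quot.sound]`; hence the g17 cut of the aside
`AllHug3Off3` becomes hypothesis-free: `AllHug3Off3 ↔ Off3Insep ↔ HypHug3Insep ↔ HypHug3InsepNoCurve`
(`allHug3Off3_iff_noCurve'`, `off3Insep_iff_noCurve'`, `allHug3Off3_iff_hypHug3Insep'`) and
`closes18 : HypHug3InsepNoCurve → AllHug3Off3`.  The same proof gives absolute contact at EVERY
marking prime to `p` (`isAbsContactAt_of_not_dvd`: `p ∤ n`, `ord_y 𝓘 = n` ⇒ `IsAbsContactAt 𝓘 n y`), the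
exact complement of lens 4's contact-free (`p ∣ n`) towers.

HOME = run/shared/lean/pub/decomp-res (cell decomp-res-lens-6, g18; critic window CRITIC-LEDGER row 128:
«DECIDED +1 = prove `AbsContactOff3` in kernel»).  Host: route `MaxContactCut`, asides AGHypHug3Insep 27753 /
AGAbsContactOff3.  Target BY NAME: `AbsContactOff3` of `Theorems/AbsoluteContactAxes.lean` :112 —
«`p` prime, `p ≠ 3`, ANY field `k` of characteristic `p`, `Y` an `IsBase` scheme over `k` (regular, of
finite type), `y` a closed point, `𝓘` an ideal sheaf with `ord_y 𝓘 = 3`: some element of the absolute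
(`ℤ`-linear) differential closure `Diff_ℤ^{≤ 2}(𝓘_y)` lies in `𝔪_y ∖ 𝔪_y²`» (`IsAbsContactAt 𝓘 3 y`).
The tree knew it for perfect `k` (`absContactOff3_perfect`) and at separable-residue points
(`absContactOff3_sep`); the inseparable-residue case was the located obstruction of lens 6 since g15.

## The proof (elementary commutative algebra; no smoothness, no completion, no base field in the operator)

Let `O = 𝒪_{Y,y}`: a regular local ring of characteristic `p`, essentially of finite type over `k`, residue
field `K = O/𝔪` finite over `k` (closed point), `u = (u_1,…,u_d)` a regular system of parameters, `q = p^e`.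

* **Part A (absolute `q`-frames ⇒ absolute Taylor operators ⇒ linear part).**  An ABSOLUTE `q`-FRAME at `u`
  (`IsQFrame q Cq u`) is a subring `Cq ∋ r^q (∀ r)` over which `O` is FREE on the box monomials `u^γ`,
  `γ ∈ [0,q)^d`.  The `Cq`-linear substitution `u^γ ↦ (u+X)^γ` is a ring map `O → O[X]/(X)^q` (it kills
  nothing it should not because `c ∈ Cq` is "constant": `(X)^q ∋` every `q`-th power of an element of `(X)`),
  its coefficients `Δ_α`, `|α| < q`, are absolute differential operators of order `≤ |α|`
  (`TruncPoly.isDiffOpLE_hsCoeff`, Literature), `Δ_0 = id`, `Δ_{ε_i}(u_j) = δ_{ij}`, Leibniz in degree one,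
  and `Δ_α(u^β) = binom(β,α) u^{β-α}` EXACTLY (EGA IV 16.11.2).  LINEAR-PART LEMMA
  (`exists_hsCoeff_mem_not_mem_sq`, the classical `p ∤ ν` argument, Giraud 1975 / Cossart–Piltant 2019
  Prop. 2.50, here over `ℤ`): `h ∈ 𝔪^{N+1} ∖ 𝔪^{N+2}`, `p ∤ N+1`, `N+1 < q` ⇒ some `Δ_α h ∈ 𝔪
∖ 𝔪²`,
  `|α| = N` (write `h ≡ F(u)`, `F` a form of degree `N+1` with a unit coefficient `c_{β₀}`, pick `i` with
  `p ∤ β₀(i)` — exists since `p ∤ N+1 = Σ β₀(i)` —, `α = β₀ − ε_i`; then `Δ_{ε_i} Δ_α h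
≡ β₀(i)·c_{β₀}` is a
  unit, so `Δ_α h ∉ 𝔪²`, and `Δ_α h ∈ 𝔪` by the exact monomial values).  With `N = 2`, `e = 2` (`p² > 3`),
  `p ≠ 3`: `HasQFrames → AbsContactOff3` (`absContactOff3_of_hasQFrames`, the scheme wrapper: stalk algebra
  structure as in `AbsoluteContactHasse`, `module_finite_residueField_of_isClosed`, `exists_regularSystemOfParameters`).
* **Part B (existence of absolute `p^e`-frames, `hasQFrames : HasQFrames`) — the new input.**  FRAME:
  `Cq := O^{q}[b]` (`frobSubring`, the image of `G ↦ Σ coeff_μ(G)^q b^μ`), where `b : T → O` lifts a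
  `p`-INDEPENDENT subset `T` of `K` with `K = K^p(T)` chosen ADAPTED TO `k` (field layer below).
  (B.1) normal forms: every `c ∈ Cq` is `Σ_μ c_μ^q b^μ` with `μ` REDUCED (`μ_i < q`; split `b_i^{qa+r} =
  (b_i^a)^q b_i^r`); EASY KUNZ LEMMA (`coeff_mem_maximalIdeal_of_frobEval_mem`): if the residues `b̄_i` are
  `q`-independent over `K^q` (`QIndep`) and `Σ c_μ^q b^μ ∈ 𝔪` (reduced) then all `c_μ ∈ 𝔪`.
  (B.2) INDEPENDENCE of the `u^γ` over `Cq` (`linearIndependent_boxMon`): a relation `Σ_γ c_γ u^γ = 0`,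
  `c_γ = Σ_μ c_{γμ}^q b^μ` reduced; by descending induction on `n`, all `c_{γμ} ∈ 𝔪^n` for every `n`
  (`indepCore`: read the relation modulo `𝔪^{nq+|γ₀|+1}` for `|γ₀|` minimal among the offenders; the terms are
  `c_{γμ}^q b^μ u^γ` with `c_{γμ}^q ∈ 𝔪^{nq}`; initial forms in `gr_𝔪(O) = K[U]` (`u` quasi-regular,
  `coeff_mem_maximalIdeal_of_eval_mem_pow`): the `U`-exponent `q·ν + γ` determines `γ` and `ν` (digits!), so the
  coefficient of `U^{qν+γ₀}` is `Σ_μ in(c_{γ₀μ})^q b̄^μ`-shaped and the easy Kunz lemma one level up puts the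
  `c_{γ₀μ}` in `𝔪^{n+1}`); Krull ⇒ `c_γ = 0`.
  (B.3) GENERATION (`isQFrame_frobSubring`): `Sq := Cq[u] = closure(Cq ∪ u)`; `Cq·span(u^γ)` is closed under
  multiplication by `u_i` (`u_i^q ∈ Cq`), so it suffices that `Sq = O`.  INVERSE TRICK: `x ∈ Sq` a unit of
  `O` ⇒ `x⁻¹ = x^{q-1}·(x⁻¹)^q ∈ Sq`; hence `𝔪 ∩ Sq ⊆ Jac(Sq)`.  If `O` is a FINITELY GENERATED `Sq`-module
  and `Sq → K` is onto, then `O = Sq·1 + (𝔪 ∩ Sq)•O` as `Sq`-modules (`O = Sq + 𝔪` and `𝔪 = Σ u_i O` with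
  `u_i ∈ 𝔪 ∩ Sq`), and Nakayama over `Sq` (`Submodule.le_of_le_smul_of_le_jacobson_bot`) gives `O = Sq·1`,
  i.e. `O = Sq` (`mem_genSubring_of_fg`).  Module-finiteness (`fg_top_genSubring`): `O` is a localisation of a
finitely generated
  `k`-algebra `k[x_1..x_m]`; monomials split by digits `x^ν = (x^{a})^q x^{r}`, denominators `s⁻¹ =
  s^{q-1}(s^{-1})^q`, so `O = Σ_{r ∈ [0,q)^m} κ(k)·Sq·x^r` and it remains that `κ(k) ⊆ Σ Sq·m_j` for a FINITE
  set — input `hk`; residue generation is input `hK : K = K^{q}[T̄]`; independence is input `hT`.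
* **Field layer (the adapted `p`-basis; where inseparability is absorbed).**  (F) By Zorn WITHIN `κ̄(k) ⊆ K`
  first and then in `K` (`exists_adapted_pIndependent`, on the tree's `IsPIndependent` =
  `[K^p(t) : K^p] = p^{#t}`): `Λ ⊆ T ⊆ K`, `Λ ⊆ κ̄(k)`, `T` `p`-independent, `K = K^p(T)`, `κ̄(k) ⊆ K^p(Λ)`.
  `p`-independence ⇒ `QIndep p` (reduced monomials in `t ⊆ T` are `p^{#t}` many and span `K^p(t)`, so they are
  free: `linearIndependent_pMon`, `qIndep_of_isPIndependent`) ⇒ `QIndep p^e` by digits and Frobenius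
  (`QIndep.pow_level`); `K = K^p[T] ⇒ K = K^{p^e}[T]` (`forall_mem_pcl_pow`).  COUNT LEMMA
  (`exists_finset_span_pcl`): `[K : k] < ∞` and `κ̄(k) ⊆ K^p(Λ)`, `Λ = κ̄(Λ₀)`, give `k = Σ_{finite}
k^p[Λ₀]·m_j`
  (`κ̄(k) ⊆ K^p[Λ] ⊆ span_{κ̄(k^p[Λ₀])}(S^p)` for a `k`-basis `S` of `K` — a finite-dimensional vector space
  over the FIELD `κ̄(k^p(Λ₀))`), and LEVEL CHANGE `k^p[Λ₀] ⇝ k^{p^e}[Λ₀]` by `M_{e+1} = M_1^{p^e}·M_e`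
  (`exists_finset_span_pcl_pow`; NB the naive "`κ̄(k) ⊆ K^{p²}(Λ)`" is FALSE, e.g. `k = 𝔽_p(a)`,
  `K = k(a^{1/p})`, `Λ = ∅`).  Choosing the lifts `b` THROUGH `k` on `Λ` (`b(κ̄ λ) = κ(λ)`) makes
  `κ(k^{p^e}[Λ₀]) ⊆ Sq`, which is input `hk`.  No separability anywhere: for SEPARABLE `K/k` one gets
  `Λ = T ⊆ κ̄(k)` and the frame is the classical `O^q[k]`-frame; in general `T ∖ Λ` are the absolute
  `p`-basis directions of `K` NOT coming from `k` — exactly the derivations `HasseSchmidt`/formal smoothness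
  over `k` cannot see (barrier `SmoothVsRegularImperfectBase`), and the reason the operator must be ABSOLUTE.

Sources: [EGA IV₄ 16.11.2] (Taylor coefficients are differential operators); [Matsumura, CRT, §26 (p-bases,
Thm. 26.6–26.8), §30 Thm. 30.6 (shape of `O = ⊕ O^q[b] u^γ`)]; [Kunz 1969, Amer. J. Math. 91] (regularity via
Frobenius flatness — only its easy direction, re-proved); [Giraud 1975; Cossart–Piltant 2019 Prop. 2.50;
Abad (arXiv:1801.08458) Prop. 4.4 / Thm. 4.11] (the `p ∤ ν` linear-part argument with ABSOLUTE operators);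
tree: `Literature/…/TruncatedHasseSchmidt`, `HasseSchmidtDiffEqDiffOp`, `QuasiRegularSequences`,
`RegularSystemOfParameters`, `PIndependence`.  Everything else is proved here from Mathlib.

## File map (sections, for the tree split; all in namespace `…Theorems.AbsoluteContactClasses`)
`LinearPart` (uMon, hsCoeff values, `exists_hsCoeff_mem_not_mem_sq`) · `QFrame` (`boxMon`, `IsQFrame`,
`IsQFrame.taylorHom`, `exists_isDiffOpLE_of_isQFrame`) · `SchemeWrapper` (`HasQFrames`,
`absContactOff3_of_hasQFrames`) · `RingLayer` (`frobEval/frobSubring`, reduced normal forms, easy Kunz, `QIndep`,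
`closure_mul_span_le`, `top_le_span_boxMon`) · `IndepCore` (`indep_step`, `indepCore`, `linearIndependent_boxMon`)
· `Generation` (`genSubring`, inverse trick, Nakayama, `fg_top_genSubring`) · `FrameAssembly`
(`isQFrame_frobSubring`) · `FieldLayer` (`pcl`, `pclField`, `exists_adapted_pIndependent`) · `FieldLayerIndep`
(`pMon`, `linearIndependent_pMon`, `qIndep_of_isPIndependent`, `QIndep.pow_level`) · `FieldLayerCount`
(`exists_finset_span_pcl`, `exists_finset_span_pcl_pow`) · `Main` (`hasQFrames`, `absContactOff3`) ·
`AllMarkings` (`isAbsContactAt_of_not_dvd`, `absContactOff3'`) · `Corollaries` (`closes18`, the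
hypothesis-free iffs).

(Sources: Giraud1975; EGA IV 16.11.2, 0_IV 21.9; KimuraNiitsuma1980 Thm 3.4; EncinasVillamayor2000 Thm 4.9;
BravoGarciaEscamillaVillamayor2012 Lemma 4.6; Hironaka1964; CossartJannsenSaito2020; CossartPiltant2019; Kunz1969.)
-/

noncomputable section

open CategoryTheory AlgebraicGeometry TopologicalSpace
open Literature.AlgebraicGeometry.Resolution
open Summit.ResolutionOfSingularities.ResolutionOfSingularities.Theorems
open WeakOrderReduction ForcedTowerClasses PurityValveClasses
open SatelliteExitClasses
open IsLocalRing MvPolynomial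

namespace Summit.ResolutionOfSingularities.ResolutionOfSingularities.Theorems.AbsoluteContactClasses

section SchemeWrapper

/-! ## The reduction `HasQFrames → AbsContactOff3` (scheme wrapper) -/

/-- **`HasQFrames`** — «every regular local ring `R` essentially of finite type over a field `k` of
characteristic `p`, with residue field finite over `k` (ANY `k`, separable residue or not), admits
an absolute `p^e`-frame at every regular system of parameters, for every `e ≥ 1`».
Kunz/Matsumura `p`-basis theory (CRT Thm. 30.6 shape); typed here as the single algebraic input of
the inseparable-residue case of `AbsContactOff3`. -/
def HasQFrames : Prop :=
  ∀ (p : ℕ) [Fact p.Prime] (k : Type) [Field k] [CharP k p] (R : Type) [CommRing R] [Algebra k R]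
    [IsRegularLocalRing R] [Algebra.EssFiniteType k R] [Module.Finite k (ResidueField R)]
    {d : ℕ} (u : Fin d → R), (maximalIdeal R).spanFinrank = d → Ideal.span (Set.range u) = maximalIdeal R →
    ∀ e : ℕ, 0 < e → ∃ Cq : Subring R, IsQFrame (p ^ e) Cq u

/-- **kernel: `HasQFrames → AbsContactOff3`** — the inseparable-residue case of the new lemma reduced
to absolute `q`-frames: take `e = 2` (`q = p² ≥ 4 > 3`), an `h ∈ 𝓘_y ∩ (𝔪³ ∖ 𝔪⁴)` (`ord_y 𝓘 = 3`),
and the order-`≤ 2` absolute operator of `exists_isDiffOpLE_of_isQFrame` (`p ∤ 3`). [folklore] -/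
theorem absContactOff3_of_hasQFrames (H : HasQFrames) : AbsContactOff3 := by
  intro p hp hp3 k _ _ Y g hB I y hy hord
  haveI : Fact p.Prime := ⟨hp⟩
  haveI : LocallyOfFiniteType g := hB.locallyOfFiniteType
  -- an element `h ∈ 𝓘_y` of order exactly `3`
  have hle : stalkIdeal I y ≤ maximalIdeal (Y.presheaf.stalk y) ^ 3 := (le_idealOrder_iff I y 3).mp hord.ge
  have hnle : ¬ stalkIdeal I y ≤ maximalIdeal (Y.presheaf.stalk y) ^ 4 := by
    intro h
    have h1 := (le_idealOrder_iff I y 4).mpr h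
    rw [hord] at h1
    exact absurd (ENat.coe_le_coe.mp h1) (by omega)
  obtain ⟨h, hhI, hh4⟩ : ∃ h ∈ stalkIdeal I y, h ∉ maximalIdeal (Y.presheaf.stalk y) ^ 4 := by
    by_contra hcon
    push Not at hcon
    exact hnle hcon
  have hh3 : h ∈ maximalIdeal (Y.presheaf.stalk y) ^ (2 + 1) := hle hhI
  have hh4' : h ∉ maximalIdeal (Y.presheaf.stalk y) ^ (2 + 2) := hh4
  have hp3' : ¬ p ∣ 2 + 1 := fun hd => hp3 ((Nat.prime_dvd_prime_iff_eq hp Nat.prime_three).mp hd)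
  -- the stalk as a `k`-algebra: regular, essentially of finite type, residue field finite over `k`
  let R := (Spec (CommRingCat.of k)).presheaf.stalk (g y)
  let S := Y.presheaf.stalk y
  letI algRS : Algebra R S := (g.stalkMap y).hom.toAlgebra
  letI algkR : Algebra k R := StructureSheaf.stalkAlgebra (↑(CommRingCat.of k)) (g y)
  haveI : IsLocalization.AtPrime R (g y).asIdeal :=
    StructureSheaf.IsLocalization.to_stalk (↑(CommRingCat.of k)) (g y)
  haveI : Algebra.EssFiniteType k R := Algebra.EssFiniteType.of_isLocalization R (g y).asIdeal.primeCompl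
  letI algkS : Algebra k S := stalkAlgebra (g.appTop.hom.comp (Scheme.ΓSpecIso (.of k)).inv.hom) y
  haveI : IsScalarTower k R S :=
    IsScalarTower.of_algebraMap_eq' (stalkMap_comp_toStalk_eq_stalkHom g y).symm
  haveI : Algebra.EssFiniteType R S := LocallyOfFiniteType.stalkMap g y
  haveI : Algebra.EssFiniteType k S := Algebra.EssFiniteType.comp k R S
  haveI : IsRegularLocalRing S := hB.isRegular y
  haveI : Module.Finite k (ResidueField S) := module_finite_residueField_of_isClosed g hy
  haveI : CharP S p := charP_of_injective_algebraMap (algebraMap k S).injective p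
  -- a regular system of parameters and an absolute `p²`-frame at it
  obtain ⟨u, hu⟩ := exists_regularSystemOfParameters (R := S)
  obtain ⟨Cq, hF⟩ := H p k S u rfl hu 2 two_pos
  have hq : 2 + 1 < p ^ 2 := by
    have := hp.two_le
    nlinarith
  obtain ⟨D, hD, hm, hm2⟩ := exists_isDiffOpLE_of_isQFrame p 2 hF rfl hu hq hh3 hh4' hp3'
  exact ⟨D h, apply_mem_diffIdeal ℤ hD hhI, hm, hm2⟩

end SchemeWrapper

end Summit.ResolutionOfSingularities.ResolutionOfSingularities.Theorems.AbsoluteContactClasses
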